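import Summits.HodgeConjecture.HodgeConjecture.Theorems.F0P3bCharDistReduction
import Literature.NumberTheory.Rogawski1990.FinExplicitTransferFactorConjRight
import Literature.NumberTheory.Rogawski1990.CharIdentityOnTestFunctionsSignedLemmas
import Literature.NumberTheory.Automorphic.IrreducibleClassesBoxChar
import Literature.NumberTheory.Automorphic.LocalHermitianFormSign
import Literature.NumberTheory.Automorphic.UnitaryGroupPrincipalSeriesH
import HarnessLib

/-!
# R90 · S3 · hand p02, second file «lds-H» — the endoscopic expansion of an L.D.S. `H_v`-packet `JH(i_H(θ̃μ⁻¹))` (H-list TYPE (6))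
# [Rogawski1990, §12.1 p. 171 (6); §12.2 p. 174; Lemma 4.9.2 p. 56]

R90-TF SLAB (brief v2 1f40d54518340a35), section S3 (Ch. 12–13 non-archimedean character identities), dealer R90-C12-plan (g0), DEAL
`R90/S3/DEAL-S3-WAVE1.R90-C12-plan-g0.md` 708593ee0d0a3c33 hand p02, SECOND FILE «T4 lds» (dealer 15:57:31Z (c)) in the CORRECTED form T4a of the seat's
census ADDENDUM 1 (`R90/R90-C14-p02/g0/CENSUS-A1-steinberg.md` 5816ee77a987a243); seat R90-C14-p02 (g0); crux H413 = `stmt-HodgeConjecture-24833`, route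
`HCCMUnconditional`, lane `--supports … --as helper`.  One theorem; no definition, no instance, no notation, no `sorry`; imports ★ Literature ∕ Theorems only.

THE CLAUSE.  Socket A1 `R90_S3_EndoCharIdentityA.stub_R90_S3_endoExpansion_exists` (integer expansion `Σ_{σ∈ρ} Tr σ(f^H) = Σ_π c(π) Tr π(f)` on `Δ‴_v`-matched
test pairs; `R90.S3.IsEndoExpansion`, UNFOLDED byte for byte from tree `R90_S3_EndoFibreDefsC.lean` :87–:91) for the `H_v`-packets of print's TYPE (6) (§12.1 p. 171):
«`ρ = JH(i_H(θ̃μ⁻¹))`, `θ` H-singular, `Card(ρ) = 2`» — in the tree's currency of S4-B's socket `stub_R90_S4_H_lds` (`R90_S4_HPacketsU2B.lean` :374, UNFOLDED over ★):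
`ρ = O ⊠ χ` (★ `IrrClass.boxChar`) where `O` is the set of constituents (★ `IrrClass.IsConstituentOf`) of the principal series ★ `cmPrincipalSeries L 2 v (torusCharPair … 0 χ₁ χ₂)`
of `U(Φ₂)_v` with `χ₁|F* = ω_{E∕F}` (★ `IsQuadraticCharExtension`) — hypothesis `hL`.  PRINT for this type: «If `ρ = JH(i_H(χ))`, `χ ∈ Hom(M, ℂ*)` unitary, then
`Π(ρ) = JH(i_G(χμ))`» (§12.2 p. 174 l. 1–3) together with the induced character identity `Tr i_H(χ)(f^H) = Tr i_G(χμ)(f)` (Lemma 4.9.2 p. 56) — READ SIGNED at the factor of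
record (`Δ‴_v = ε_v(H′)·Δ_v`, `ε_v(H′) = formSignAt L c H′ v`, ★ `LocalHermitianFormSign`) — gives the expansion with coefficients `(1, 1)` on the two constituents of `i_G(θ̃)`
(the l.d.s. packet `Π(θ′) = {π₁(θ′), π₂(θ′)}` of the `G`-equivalent semi-regular `θ′`, §12.2 (6), Prop. 13.1.2 (c)).  That printed input is the NAMED HYPOTHESIS `hIND`,
keyed on `hL`'s data: `∃ π_a π_b : Irr(G_v)`, `Σ_{σ∈ρ} Tr σ(f^H) = ε_v(H′)·(Tr π_a(f) + Tr π_b(f))` on `Δ‴_v`-matched test pairs (identity only — print's `π_a ≠ π_b` is not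
needed for the EXISTENCE of the expansion).  CAUTION recorded in the census: this is NOT Prop. 13.1.3 (c) («`ρ = ρ(θ)`, `θ` semi-regular ⇒ coefficients `(1, −1)`»): a
semi-regular `θ` is H-REGULAR, its `ρ(θ)` has a SUPERCUSPIDAL `U(Φ₂)`-part (Prop. 11.1.1 (e), TYPE (5)); on TYPE (6) the signs are `(1, 1)`.

THE PROOF.  `c := single π_a ε + single π_b ε` (`ε = formSignAt … ∈ ℤ`); `Finsupp.sum_add_index'`, `Finsupp.sum_single_index`.  The record side conditions of A1 and
`hρ : IsRogPacketH L v ρ` are not used and therefore not binders (p01 pattern of record).  File A ED. 2 ∕ the S3 assembly close the type-(6) case by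
`exact endoExpansion_exists_of_ldsH L H′ v μ νG νH mH mG ρ hL hIND` (δ-unfolding `IsEndoExpansion`).

HONEST LABEL: HC_CM is proved only modulo the 7 printed citations (2 remaining named inputs: hLiu418 = stmt-HodgeConjecture-24832, h413 = stmt-HodgeConjecture-24833)
until rung 0 closes; this file proves the type-(6) A1 clause CONDITIONALLY on the printed induced identity (named hypothesis `hIND`); REL ≠ ★ ≠ BUILT.

## References
* [Rogawski1990] J. D. Rogawski, *Automorphic Representations of Unitary Groups in Three Variables*, Ann. of Math. Stud. 123 (1990): §4.9 Lemma 4.9.2 p. 56;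
  §11.1 Prop. 11.1.1 p. 161; §12.1 p. 171; §12.2 p. 174; §13.1 Thm. 13.1.1 (2), Prop. 13.1.2 (c) p. 198, Prop. 13.1.3 (c) p. 199; §14.6 p. 242 (the sign `c_v`).
-/

set_option autoImplicit false
-- the mandated namespace repeats the single-problem summit's segment (`HodgeConjecture.HodgeConjecture`)
set_option linter.dupNamespace false

noncomputable section

namespace Summit.HodgeConjecture.HodgeConjecture.R90.S3

open MeasureTheory IsDedekindDomain NumberField
open Literature.NumberTheory Literature.NumberTheory.Automorphic Literature.NumberTheory.Automorphic.UnitaryGroup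
open Literature.NumberTheory.Rogawski1990 Literature.NumberTheory.GaloisRepresentations
open scoped Matrix

variable (L : Type) [Field L] [NumberField L] [IsCMField L] (H' : Matrix (Fin 3) (Fin 3) L)
  (v : HeightOneSpectrum (𝓞 ↥(maximalRealSubfield L)))

/-- **A1 for the L.D.S. `H_v`-packets `JH(i_H(θ̃μ⁻¹))` (H-list TYPE (6)).**  At the record local data of socket A1, for a finite set `ρ` of classes of `H_v`
of the form `O ⊠ χ`, `O` = the constituents of `i_{U(Φ₂)}((χ₁, χ₂))` with `χ₁|F* = ω_{E∕F}` (`hL`, S4-B's `stub_R90_S4_H_lds` shape), GIVEN print's induced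
identity at the factor of record (`hIND`: `Σ_{σ∈ρ} Tr σ(f^H) = ε_v(H′)·(Tr π_a(f) + Tr π_b(f))` on `Δ‴_v`-matched test pairs), there is an integer expansion
`c = ε_v(H′)·(1·π_a + 1·π_b)` with `Σ_{σ∈ρ} Tr σ(f^H) = Σ_π c(π) Tr π(f)` for every `Δ‴_v`-matched pair of test functions.
[cite: Rogawski1990, §4.9 Lemma 4.9.2 p. 56; §12.1 p. 171; §12.2 p. 174; §13.1 Thm. 13.1.1 (2), Prop. 13.1.2 (c) p. 198; §14.6 p. 242] -/
theorem endoExpansion_exists_of_ldsH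
    (μ : HeckeCharacter L)
    [MeasurableSpace ((UnitaryGroup.cmDatum L 3 H').Local v)] [BorelSpace ((UnitaryGroup.cmDatum L 3 H').Local v)]
    [MeasurableSpace ((UnitaryGroup.cmDatum L 2 (Matrix.of fun i j : Fin 2 => if i.val + j.val + 1 = 2 then (1 : L) else 0)).Local v ×
      (UnitaryGroup.cmDatum L 1 (Matrix.of fun i j : Fin 1 => if i.val + j.val + 1 = 1 then (1 : L) else 0)).Local v)]
    [BorelSpace ((UnitaryGroup.cmDatum L 2 (Matrix.of fun i j : Fin 2 => if i.val + j.val + 1 = 2 then (1 : L) else 0)).Local v ×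
      (UnitaryGroup.cmDatum L 1 (Matrix.of fun i j : Fin 1 => if i.val + j.val + 1 = 1 then (1 : L) else 0)).Local v)]
    [∀ a : ((UnitaryGroup.cmDatum L 2 (Matrix.of fun i j : Fin 2 => if i.val + j.val + 1 = 2 then (1 : L) else 0)).Local v ×
      (UnitaryGroup.cmDatum L 1 (Matrix.of fun i j : Fin 1 => if i.val + j.val + 1 = 1 then (1 : L) else 0)).Local v),
      MeasurableSpace (((UnitaryGroup.cmDatum L 2 (Matrix.of fun i j : Fin 2 => if i.val + j.val + 1 = 2 then (1 : L) else 0)).Local v ×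
      (UnitaryGroup.cmDatum L 1 (Matrix.of fun i j : Fin 1 => if i.val + j.val + 1 = 1 then (1 : L) else 0)).Local v) ⧸
        Subgroup.centralizer ({a} : Set ((UnitaryGroup.cmDatum L 2 (Matrix.of fun i j : Fin 2 => if i.val + j.val + 1 = 2 then (1 : L) else 0)).Local v ×
      (UnitaryGroup.cmDatum L 1 (Matrix.of fun i j : Fin 1 => if i.val + j.val + 1 = 1 then (1 : L) else 0)).Local v)))]
    [∀ a : ((UnitaryGroup.cmDatum L 2 (Matrix.of fun i j : Fin 2 => if i.val + j.val + 1 = 2 then (1 : L) else 0)).Local v ×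
      (UnitaryGroup.cmDatum L 1 (Matrix.of fun i j : Fin 1 => if i.val + j.val + 1 = 1 then (1 : L) else 0)).Local v),
      BorelSpace (((UnitaryGroup.cmDatum L 2 (Matrix.of fun i j : Fin 2 => if i.val + j.val + 1 = 2 then (1 : L) else 0)).Local v ×
      (UnitaryGroup.cmDatum L 1 (Matrix.of fun i j : Fin 1 => if i.val + j.val + 1 = 1 then (1 : L) else 0)).Local v) ⧸
        Subgroup.centralizer ({a} : Set ((UnitaryGroup.cmDatum L 2 (Matrix.of fun i j : Fin 2 => if i.val + j.val + 1 = 2 then (1 : L) else 0)).Local v ×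
      (UnitaryGroup.cmDatum L 1 (Matrix.of fun i j : Fin 1 => if i.val + j.val + 1 = 1 then (1 : L) else 0)).Local v)))]
    [∀ γ : ((UnitaryGroup.cmDatum L 3 H').Local v), MeasurableSpace (((UnitaryGroup.cmDatum L 3 H').Local v) ⧸ Subgroup.centralizer ({γ} : Set ((UnitaryGroup.cmDatum L 3 H').Local v)))]
    [∀ γ : ((UnitaryGroup.cmDatum L 3 H').Local v), BorelSpace (((UnitaryGroup.cmDatum L 3 H').Local v) ⧸ Subgroup.centralizer ({γ} : Set ((UnitaryGroup.cmDatum L 3 H').Local v)))]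
    (νG : Measure ((UnitaryGroup.cmDatum L 3 H').Local v)) [νG.IsHaarMeasure] [νG.IsMulRightInvariant]
    (νH : Measure ((UnitaryGroup.cmDatum L 2 (Matrix.of fun i j : Fin 2 => if i.val + j.val + 1 = 2 then (1 : L) else 0)).Local v ×
      (UnitaryGroup.cmDatum L 1 (Matrix.of fun i j : Fin 1 => if i.val + j.val + 1 = 1 then (1 : L) else 0)).Local v))
    [νH.IsHaarMeasure] [νH.IsMulRightInvariant]
    (mH : OrbitalMeasureFamily ((UnitaryGroup.cmDatum L 2 (Matrix.of fun i j : Fin 2 => if i.val + j.val + 1 = 2 then (1 : L) else 0)).Local v ×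
      (UnitaryGroup.cmDatum L 1 (Matrix.of fun i j : Fin 1 => if i.val + j.val + 1 = 1 then (1 : L) else 0)).Local v))
    (mG : OrbitalMeasureFamily ((UnitaryGroup.cmDatum L 3 H').Local v))
    (ρ : Finset (IrrClass ((UnitaryGroup.cmDatum L 2 (Matrix.of fun i j : Fin 2 => if i.val + j.val + 1 = 2 then (1 : L) else 0)).Local v ×
      (UnitaryGroup.cmDatum L 1 (Matrix.of fun i j : Fin 1 => if i.val + j.val + 1 = 1 then (1 : L) else 0)).Local v)))
    (hL : ∃ (O : Finset (IrrClass ((UnitaryGroup.cmDatum L 2 (Matrix.of fun i j : Fin 2 => if i.val + j.val + 1 = 2 then (1 : L) else 0)).Local v)))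
        (χ : (UnitaryGroup.cmDatum L 1 (Matrix.of fun i j : Fin 1 => if i.val + j.val + 1 = 1 then (1 : L) else 0)).Local v →* ℂˣ)
        (hχ : IsOpen ((χ.ker : Subgroup ((UnitaryGroup.cmDatum L 1 (Matrix.of fun i j : Fin 1 => if i.val + j.val + 1 = 1 then (1 : L) else 0)).Local v)) :
          Set ((UnitaryGroup.cmDatum L 1 (Matrix.of fun i j : Fin 1 => if i.val + j.val + 1 = 1 then (1 : L) else 0)).Local v)))
        (χ₁ : (UnitaryGroup.LocalRing L v)ˣ →* ℂˣ) (χ₂ : ↥(normOneUnits (conjLocal L (IsCMField.complexConj L) v)) →* ℂˣ),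
        IsQuadraticCharExtension (conjLocal L (IsCMField.complexConj L) v) χ₁ ∧
        (∀ c : IrrClass ((UnitaryGroup.cmDatum L 2 (Matrix.of fun i j : Fin 2 => if i.val + j.val + 1 = 2 then (1 : L) else 0)).Local v), c ∈ O ↔
          c.IsConstituentOf
            (cmPrincipalSeries L 2 v
              (torusCharPair (conjLocal L (IsCMField.complexConj L) v) (cmLocalForm L 2 v) (cmLocalForm_eq_over L 2 v) 0 χ₁ χ₂))) ∧
        ρ = O.map ⟨IrrClass.boxChar χ hχ, IrrClass.boxChar_injective χ hχ⟩)
    (hIND : ∀ (O : Finset (IrrClass ((UnitaryGroup.cmDatum L 2 (Matrix.of fun i j : Fin 2 => if i.val + j.val + 1 = 2 then (1 : L) else 0)).Local v)))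
        (χ : (UnitaryGroup.cmDatum L 1 (Matrix.of fun i j : Fin 1 => if i.val + j.val + 1 = 1 then (1 : L) else 0)).Local v →* ℂˣ)
        (hχ : IsOpen ((χ.ker : Subgroup ((UnitaryGroup.cmDatum L 1 (Matrix.of fun i j : Fin 1 => if i.val + j.val + 1 = 1 then (1 : L) else 0)).Local v)) :
          Set ((UnitaryGroup.cmDatum L 1 (Matrix.of fun i j : Fin 1 => if i.val + j.val + 1 = 1 then (1 : L) else 0)).Local v)))
        (χ₁ : (UnitaryGroup.LocalRing L v)ˣ →* ℂˣ) (χ₂ : ↥(normOneUnits (conjLocal L (IsCMField.complexConj L) v)) →* ℂˣ),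
        IsQuadraticCharExtension (conjLocal L (IsCMField.complexConj L) v) χ₁ →
        (∀ c : IrrClass ((UnitaryGroup.cmDatum L 2 (Matrix.of fun i j : Fin 2 => if i.val + j.val + 1 = 2 then (1 : L) else 0)).Local v), c ∈ O ↔
          c.IsConstituentOf
            (cmPrincipalSeries L 2 v
              (torusCharPair (conjLocal L (IsCMField.complexConj L) v) (cmLocalForm L 2 v) (cmLocalForm_eq_over L 2 v) 0 χ₁ χ₂))) →
        ρ = O.map ⟨IrrClass.boxChar χ hχ, IrrClass.boxChar_injective χ hχ⟩ →
          ∃ πa πb : IrrClass ((UnitaryGroup.cmDatum L 3 H').Local v),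
            ∀ (fH : (UnitaryGroup.cmDatum L 2 (Matrix.of fun i j : Fin 2 => if i.val + j.val + 1 = 2 then (1 : L) else 0)).Local v ×
        (UnitaryGroup.cmDatum L 1 (Matrix.of fun i j : Fin 1 => if i.val + j.val + 1 = 1 then (1 : L) else 0)).Local v → ℂ)
              (f : (UnitaryGroup.cmDatum L 3 H').Local v → ℂ),
              IsLocSmooth fH → IsLocSmooth f →
                IsLocalDeltaTransfer L H' v
                  (finExplicitCollection L H' μ (finExplicitDelta_conj_left_all L H' μ) (finExplicitDelta_conj_right_all L H' μ) v) mH mG fH f →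
                ∑ σ ∈ ρ, σ.smoothTrace νH fH =
                  ((formSignAt L (IsCMField.complexConj L) H' v : ℤ) : ℂ) * (πa.smoothTrace νG f + πb.smoothTrace νG f)) :
    ∃ c : IrrClass ((UnitaryGroup.cmDatum L 3 H').Local v) →₀ ℤ,
      ∀ (fH : (UnitaryGroup.cmDatum L 2 (Matrix.of fun i j : Fin 2 => if i.val + j.val + 1 = 2 then (1 : L) else 0)).Local v ×
        (UnitaryGroup.cmDatum L 1 (Matrix.of fun i j : Fin 1 => if i.val + j.val + 1 = 1 then (1 : L) else 0)).Local v → ℂ)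
        (f : (UnitaryGroup.cmDatum L 3 H').Local v → ℂ),
        IsLocSmooth fH → IsLocSmooth f →
          IsLocalDeltaTransfer L H' v
            (finExplicitCollection L H' μ (finExplicitDelta_conj_left_all L H' μ) (finExplicitDelta_conj_right_all L H' μ) v) mH mG fH f →
          ∑ σ ∈ ρ, σ.smoothTrace νH fH = ∑ π ∈ c.support, (c π : ℂ) * π.smoothTrace νG f := by
  classical
  obtain ⟨O, χ, hχ, χ₁, χ₂, hq, hO, hρ⟩ := hL
  obtain ⟨πa, πb, hid⟩ := hIND O χ hχ χ₁ χ₂ hq hO hρ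
  -- bookkeeping for `Finsupp.sum` against `π ↦ n ↦ (n : ℂ) * Tr π(f)`
  have h0 : ∀ (f : (UnitaryGroup.cmDatum L 3 H').Local v → ℂ) (π : IrrClass ((UnitaryGroup.cmDatum L 3 H').Local v)),
      (((0 : ℤ) : ℤ) : ℂ) * π.smoothTrace νG f = 0 := fun f π => by simp
  have hadd : ∀ (f : (UnitaryGroup.cmDatum L 3 H').Local v → ℂ) (π : IrrClass ((UnitaryGroup.cmDatum L 3 H').Local v)) (m n : ℤ),
      ((m + n : ℤ) : ℂ) * π.smoothTrace νG f = (m : ℂ) * π.smoothTrace νG f + (n : ℂ) * π.smoothTrace νG f := fun f π m n => by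
    push_cast; ring
  -- `c := single π_a ε + single π_b ε`, `ε = ε_v(H′)`
  refine ⟨Finsupp.single πa (formSignAt L (IsCMField.complexConj L) H' v) +
    Finsupp.single πb (formSignAt L (IsCMField.complexConj L) H' v), fun fH f hfH hf hΔ => ?_⟩
  change _ = (Finsupp.single πa (formSignAt L (IsCMField.complexConj L) H' v) +
    Finsupp.single πb (formSignAt L (IsCMField.complexConj L) H' v)).sum (fun π n => (n : ℂ) * π.smoothTrace νG f)
  rw [Finsupp.sum_add_index' (h0 f) (hadd f), Finsupp.sum_single_index (h0 f πa), Finsupp.sum_single_index (h0 f πb),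
    hid fH f hfH hf hΔ, mul_add]

end Summit.HodgeConjecture.HodgeConjecture.R90.S3

end
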